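import Summits.ResolutionOfSingularities.ResolutionOfSingularities.Theorems.FrobeniusLadderFInjectiveMacaulayficationProp44SliceCurvePlumbing
import Summits.ResolutionOfSingularities.ResolutionOfSingularities.Theorems.FrobeniusLadderFInjectiveMacaulayficationProp44Invariants
import Summits.ResolutionOfSingularities.ResolutionOfSingularities.Theorems.FrobeniusLadderFInjectiveMacaulayficationProp44SliceDimTwoCodim
import Literature.AlgebraicGeometry.Resolution.CurveGenericChainTermination
import Literature.AlgebraicGeometry.Resolution.CurveCentreNearPointDimension
import Literature.AlgebraicGeometry.Resolution.NearPointsCurveCentre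
import Literature.AlgebraicGeometry.Resolution.OrderSemicontinuity
import Literature.AlgebraicGeometry.Resolution.BlowupDimension
import HarnessLib

/-!
# [CoP1] Prop. 4.4 (`CossartPiltant2008_prop44`, F-71): the curve step with LOCAL oracles, and its contrapositive (the DESCENT form the
# `τ = 1` point-slice assembly consumes)

[L1 W4.5a · crux `FInjectiveMacaulayfication` (stmt-ResolutionOfSingularities-15315); D-0154 (2) RES inputs cell, seat res-inputs-p-8b (gen 2,
«assembly»), on the request of res-inputs-p-8a (S3 = `τ = 1` point-slice assembly in descent form). PROVED, fact-free, definition-free;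
nothing of the manuscript under adjudication is used. AI-written; AI review is weaker than expert review.]

THE POINT. `…Prop44SliceCurve.lean` (p620059) derives the regular-curve slice from the isolated `τ = 1` point slice taken as a GLOBAL
oracle. But the point slice itself recurses through curve steps (after blowing up an isolated `τ = 1` point the near locus may be the whole
directrix line `L_x`), so the honest assembly of both is ONE descent whose well-foundedness is Cossart–Piltant's `τ = 1` chain argument. For
that the curve step is needed with its two oracles LOCALISED to the one blowing up `π : X′ → X` of the curve `Y = cl{η}`, and in
CONTRAPOSITIVE form. This file provides exactly that, re-using the bookkeeping of p620059/p619773: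

* `orderReducible_comap_of_curve_step_local` — for a given blowing up `π` of `Y`: IF every near CLOSED `τ = 1` threefold point `x′` over a
  closed point of `Y`, isolated inside an open `W ⊆ π⁻¹V`, has `(W, J′|_W, m)` order-reducible (local point oracle, asked with all the binders
  of the point slice AND the invariants of `X′` supplied), and IF a near point `η′` over the generic point `η` (if any) has `(π⁻¹V, J′|_{π⁻¹V}, m)`
  order-reducible (local curve oracle), THEN `(V, J|_V, m)` is order-reducible;
* `exists_not_orderReducible_of_curve_step` — the contrapositive: if `(V, J|_V, m)` is NOT order-reducible, then EITHER some near closed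
  `τ = 1` threefold point `x′` over a closed point of `Y` with an isolating open `W ⊆ π⁻¹V` has `(W, J′|_W, m)` NOT order-reducible (all
  point-slice binders and the invariants of `X′` delivered), OR some `η′` over `η` is near and `(π⁻¹V, J′|_{π⁻¹V}, m)` is NOT order-reducible;
* `curveData_of_isNear_generic` — in the second case, GIVEN clauses 2–3 of Lemma 4.3 (4) for `Γ′ = cl{η′}` (all points near, onto `Y`:
  in tree p619499, res-inputs-p-6; regularity of `Γ′` = T2b′ clause 1 is needed only to blow `Γ′` up next), the next curve instance `(X′, J′, π⁻¹V, Γ′, η′)` satisfies all binders of the curve step again and its colength DROPPED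
  (`IsBlowup.colength_weakTransform_lt`), so the descent along the curve lineage is finite.

`CossartPiltant2008_prop44` is NOT proved; resolution in dimension `≥ 4` / positive characteristic is NOT proved.

References: V. Cossart, O. Piltant, J. Algebra 320 (2008), Lemma 4.3 (2) (4), Prop. 4.4 (proof, pp. 10–11) [CossartPiltant2008]; O. Zariski,
P. Samuel, *Commutative Algebra* II, App. 5, Thm. 3 [ZariskiSamuel1960]; O. Piltant, RACSAM 107 (2013), Prop. 5.1 [Piltant2013].
-/

-- `Summit.<Summit>.<Sub>.Theorems` with `Sub = Summit` (single-conjunct summit, D-0017)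
set_option linter.dupNamespace false

noncomputable section

open CategoryTheory CategoryTheory.Limits AlgebraicGeometry TopologicalSpace IsLocalRing
open Literature.AlgebraicGeometry.Resolution Scheme.IdealSheafData

namespace Summit.ResolutionOfSingularities.ResolutionOfSingularities.Theorems

namespace CP2008Prop44

universe u

/-! ## §1 The curve step with local oracles -/

/-- **THE CURVE STEP WITH LOCAL ORACLES.** `X` integral Noetherian regular quasi-excellent of dimension `≤ 3`; `J`, `m ≥ 1`, `ord ≤ m`, `V(J)` of
codimension `≥ 2`; `V` open, `Y = cl{η} ⊆ V` (`codim η = 2`) with `V(𝓘_Y)` regular, `ord = m` on `Y`, every point of order `≥ m` on `Y` or outside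
`V`; `π : X′ → X` a blowing up of `Y`, `J′` the weak transform. LOCAL POINT ORACLE `hptloc`: for every near CLOSED threefold point `x′` with
`τ = 1` over a closed point of `Y` and every open `W ∋ x′`, `W ⊆ π⁻¹V`, isolating `x′` among the points of order `≥ m`, `(W, J′|_W, m)` is
order-reducible (asked with the invariants of `X′` and all binders of the point slice supplied). LOCAL CURVE ORACLE `ihloc`: for every near
`η′` over `η`, `(π⁻¹V, J′|_{π⁻¹V}, m)` is order-reducible. THEN `(V, J|_V, m)` is order-reducible. (Case B is `ihloc`; case A = finitely many
near closed points, point oracle at `τ = 1` / W4.6 `orderReducible_comap_of_isolated_two_le_tau` at `τ ≥ 2`, patched over `π⁻¹V`, read over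
`V`.) [cite: CossartPiltant2008, Prop. 4.4 (proof, p. 10), Lemma 4.3 (2) (4)] [cite: Piltant2013, Prop. 5.1 (proof, Step 2)] -/
theorem orderReducible_comap_of_curve_step_local {m : ℕ} (hm : 1 ≤ m)
    {X : Scheme.{u}} [IsIntegral X] [IsNoetherian X] (hX : Scheme.IsRegular X) (hqe : Scheme.IsQuasiExcellent X)
    (hX3 : topologicalKrullDim X ≤ 3) (J : X.IdealSheafData) (hle : ∀ z, idealOrder J z ≤ m)
    (hcodim : ∀ z ∈ J.support, 1 < Order.coheight z) (V : X.Opens) (Y : Closeds X) (η : X) (hYη : (Y : Set X) = closure {η})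
    (hcoh : Order.coheight η = 2) (hreg : Scheme.IsRegular (vanishingIdeal Y).subscheme) (hYV : (Y : Set X) ⊆ (V : Set X))
    (hJY : ∀ z : X, (m : ℕ∞) ≤ idealOrder J z → z ∈ (Y : Set X) ∨ z ∉ (V : Set X))
    (hord : ∀ y ∈ (Y : Set X), idealOrder J y = m)
    {X' : Scheme.{u}} (π : X' ⟶ X) (hπ : IsBlowup π (vanishingIdeal Y))
    (hptloc : ∀ (_ : IsIntegral X') (_ : IsNoetherian X') (hX' : Scheme.IsRegular X') (_ : Scheme.IsQuasiExcellent X')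
      (_ : topologicalKrullDim X' ≤ 3) (_ : ∀ z, idealOrder (controlledTransform π (vanishingIdeal Y) J m) z ≤ m)
      (_ : ∀ z ∈ (controlledTransform π (vanishingIdeal Y) J m).support, 1 < Order.coheight z)
      (x' : X') (_ : π x' ∈ (Y : Set X)) (_ : π x' ≠ η) (_ : IsClosed ({π x'} : Set X))
      (_ : IsNear π (vanishingIdeal Y) J m x') (W : X'.Opens) (_ : x' ∈ W) (_ : W ≤ π ⁻¹ᵁ V) (_ : IsClosed ({x'} : Set X'))
      (_ : ∀ z : X', (m : ℕ∞) ≤ idealOrder (controlledTransform π (vanishingIdeal Y) J m) z → z = x' ∨ z ∉ (W : Set X'))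
      (_ : idealOrder (controlledTransform π (vanishingIdeal Y) J m) x' = m)
      (_ : (maximalIdeal (X'.presheaf.stalk x')).spanFinrank = 3)
      (_ : haveI := hX' x'; stalkTau (controlledTransform π (vanishingIdeal Y) J m) x' m = 1)
      (_ : IsGRing (X'.presheaf.stalk x')),
      CampaignW46.OrderReducible ((controlledTransform π (vanishingIdeal Y) J m).comap W.ι) m)
    (ihloc : ∀ η' : X', π η' = η → IsNear π (vanishingIdeal Y) J m η' →
      CampaignW46.OrderReducible ((controlledTransform π (vanishingIdeal Y) J m).comap (π ⁻¹ᵁ V).ι) m) :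
    CampaignW46.OrderReducible (J.comap V.ι) m := by
  classical
  have hcoh3 : ∀ z : X, Order.coheight z ≤ 3 := (topologicalKrullDim_le_iff_forall_coheight_le X 3).mp hX3
  have hD : ∀ y ∈ (Y : Set X), (m : ℕ∞) ≤ idealOrder J y := fun y hy => (hord y hy).ge
  have hpair : ∀ y ∈ (Y : Set X), haveI := hX y; ∃ c : Fin 2 → X.presheaf.stalk y, IsRsopPart c ∧
      Ideal.span (Set.range c) = stalkIdeal (vanishingIdeal Y) y := fun y hy =>
    exists_rsopPair_of_mem_curve hX hcoh3 hreg hYη hcoh hy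
  have hseq1 : CampaignW46.IsPermissibleBlowupSeq J m π (controlledTransform π (vanishingIdeal Y) J m) :=
    CampaignW46.IsPermissibleBlowupSeq.single Y π hreg hD hπ
  obtain ⟨hint', hnoeth', hX', hqe', hle', hcodim'⟩ := IsPermissibleBlowupSeq.prop44Invariants hX hqe hm hle hcodim hseq1
  haveI := hint'
  haveI := hnoeth'
  have hX3' : topologicalKrullDim X' ≤ 3 := hπ.topologicalKrullDim_le hX3
  set J' := controlledTransform π (vanishingIdeal Y) J m with hJ'def
  -- the points of `X'` of order `≥ m`: near points over `Y`, or over the complement of `V`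
  have hbad' : ∀ z : X', (m : ℕ∞) ≤ idealOrder J' z →
      (π z ∈ (Y : Set X) ∧ IsNear π (vanishingIdeal Y) J m z) ∨ π z ∉ (V : Set X) := by
    intro z hz
    by_cases hmem : π z ∈ (Y : Set X)
    · exact Or.inl ⟨hmem, isNear_iff.mpr (le_antisymm (hπ.idealOrder_controlledTransform_le_of_mem hX hreg hord hmem) hz)⟩
    · right
      have hmem' : π z ∉ ((vanishingIdeal Y).support : Set X) := by rwa [Scheme.IdealSheafData.coe_support_vanishingIdeal]
      rw [hJ'def, hπ.idealOrder_controlledTransform_of_not_mem J m hmem'] at hz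
      rcases hJY _ hz with h | h
      · exact absurd h hmem
      · exact h
  by_cases hB : ∃ η' : X', π η' = η ∧ IsNear π (vanishingIdeal Y) J m η'
  · /- CASE (B): the local curve oracle -/
    obtain ⟨η', hη'η, hnearη'⟩ := hB
    exact orderReducible_comap_of_seq_of_comap_preimage hseq1 V (ihloc η' hη'η hnearη')
  · /- CASE (A): no near point over the generic point — finitely many near closed points, patched -/
    push Not at hB
    set N : Set X' := {z : X' | π z ∈ (Y : Set X) ∧ (m : ℕ∞) ≤ idealOrder J' z} with hNdef
    have hN_near : ∀ z ∈ N, IsNear π (vanishingIdeal Y) J m z := fun z hz =>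
      isNear_iff.mpr (le_antisymm (hπ.idealOrder_controlledTransform_le_of_mem hX hreg hord hz.1) hz.2)
    have hN_ne : ∀ z ∈ N, π z ≠ η := fun z hz h => hB z h (hN_near z hz)
    have hN_base : ∀ z ∈ N, Order.coheight (π z) = 3 ∧ IsClosed ({π z} : Set X) := fun z hz =>
      isClosed_singleton_of_mem_closure_of_ne hcoh3 hcoh (hYη ▸ hz.1) (hN_ne z hz)
    have hN_closedPt : ∀ z ∈ N, IsClosed ({z} : Set X') := by
      intro z hz
      haveI := hX (π z)
      obtain ⟨c, hcr, hcY⟩ := hpair (π z) hz.1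
      exact hπ.isClosed_singleton_of_isNear_curve hX hX' hreg hm hord (hN_base z hz).2 hcr hcY (hN_near z hz)
    have hN_dim : ∀ z ∈ N, (maximalIdeal (X'.presheaf.stalk z)).spanFinrank = 3 := by
      intro z hz
      haveI := hX (π z)
      obtain ⟨c, hcr, hcY⟩ := hpair (π z) hz.1
      rw [(hπ.isRegularLocalRing_and_spanFinrank_eq_of_isNear_curve hX hreg hm hord hcr hcY (hN_near z hz)).2]
      exact spanFinrank_maximalIdeal_stalk_eq (π z) (hN_base z hz).1
    have hN_ord : ∀ z ∈ N, idealOrder J' z = m := fun z hz => isNear_iff.mp (hN_near z hz)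
    have hJ'ne : J' ≠ ⊥ := ne_bot_of_forall_one_lt_coheight hcodim'
    have hOrdCl : IsClosed {z : X' | (m : ℕ∞) ≤ idealOrder J' z} :=
      isClosed_setOf_le_idealOrder_of_isJ2 hX' (fun U => (hqe' U).isJ2Ring) hJ'ne m
    have hNcl : IsClosed N := (Y.isClosed.preimage π.continuous).inter hOrdCl
    have hNfin : N.Finite := finite_of_isClosed_of_forall_isClosed_singleton hNcl hN_closedPt
    have hNV : ∀ z : X', z ∈ ((π ⁻¹ᵁ V : X'.Opens) : Set X') → (m : ℕ∞) ≤ idealOrder J' z → z ∈ N := by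
      intro z hzV hz
      rcases hbad' z hz with ⟨hzY, -⟩ | h
      · exact ⟨hzY, hz⟩
      · exact absurd hzV h
    have hred : CampaignW46.OrderReducible (J'.comap (π ⁻¹ᵁ V).ι) m := by
      refine orderReducible_comap_of_finite_of_forall_nhds hX' J' (π ⁻¹ᵁ V) N hNfin hN_closedPt hNV fun x hx => ?_
      have hcl : IsClosed (N \ {x}) := isClosed_diff_singleton_of_finite hNfin hN_closedPt x
      let W : X'.Opens := ⟨((π ⁻¹ᵁ V : X'.Opens) : Set X') \ (N \ {x}), (π ⁻¹ᵁ V).2.sdiff hcl⟩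
      have hxW : x ∈ W := ⟨show π x ∈ (V : Set X) from hYV hx.1, fun h => h.2 rfl⟩
      have hWV : W ≤ π ⁻¹ᵁ V := fun z hz => hz.1
      have hbadW : ∀ z : X', (m : ℕ∞) ≤ idealOrder J' z → z = x ∨ z ∉ (W : Set X') := by
        intro z hz
        by_cases hzW : z ∈ (W : Set X')
        · left
          have hzN : z ∈ N := hNV z hzW.1 hz
          by_contra hne
          exact hzW.2 ⟨hzN, hne⟩
        · exact Or.inr hzW
      haveI : IsRegularLocalRing (X'.presheaf.stalk x) := hX' x
      have hG : IsGRing (X'.presheaf.stalk x) := Scheme.isGRing_stalk_of_isQuasiExcellent hqe' x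
      refine ⟨W, hxW, hWV, ?_⟩
      by_cases hτ : stalkTau J' x m = 1
      · exact hptloc hint' hnoeth' hX' hqe' hX3' hle' hcodim' x hx.1 (hN_ne x hx) (hN_base x hx).2 (hN_near x hx) W hxW hWV
          (hN_closedPt x hx) hbadW (hN_ord x hx) (hN_dim x hx) hτ hG
      · have hτ2 : 2 ≤ stalkTau J' x m := by
          have h1 : 1 ≤ stalkTau J' x m := (hN_near x hx).one_le_stalkTau hm
          omega
        exact CampaignW46.orderReducible_comap_of_isolated_two_le_tau hX' J' hm W x hxW (hN_closedPt x hx) hbadW (hN_ord x hx)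
          (hN_dim x hx) hτ2 hG
    exact orderReducible_comap_of_seq_of_comap_preimage hseq1 V hred

/-! ## §2 The contrapositive: the descent form -/

/-- **DESCENT FORM OF THE CURVE STEP.** In the situation of `orderReducible_comap_of_curve_step_local`, if `(V, J|_V, m)` is NOT
order-reducible, then EITHER there are a near CLOSED threefold point `x′` of `X′` with `τ = 1` over a closed point `π x′ ≠ η` of `Y` and an
open `W ∋ x′`, `W ⊆ π⁻¹V`, isolating `x′` among the points of order `≥ m`, with `(W, J′|_W, m)` NOT order-reducible — delivered with the
invariants of `X′` (integral, Noetherian, regular, quasi-excellent, dimension `≤ 3`, `ord J′ ≤ m`, `V(J′)` of codimension `≥ 2`) and all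
binders of the point slice (`ord = m`, embedding dimension `3`, `τ = 1`, G-ring) — OR some `η′` over `η` is near and
`(π⁻¹V, J′|_{π⁻¹V}, m)` is NOT order-reducible. [cite: CossartPiltant2008, Prop. 4.4 (proof, pp. 10–11)] -/
theorem exists_not_orderReducible_of_curve_step {m : ℕ} (hm : 1 ≤ m)
    {X : Scheme.{u}} [IsIntegral X] [IsNoetherian X] (hX : Scheme.IsRegular X) (hqe : Scheme.IsQuasiExcellent X)
    (hX3 : topologicalKrullDim X ≤ 3) (J : X.IdealSheafData) (hle : ∀ z, idealOrder J z ≤ m)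
    (hcodim : ∀ z ∈ J.support, 1 < Order.coheight z) (V : X.Opens) (Y : Closeds X) (η : X) (hYη : (Y : Set X) = closure {η})
    (hcoh : Order.coheight η = 2) (hreg : Scheme.IsRegular (vanishingIdeal Y).subscheme) (hYV : (Y : Set X) ⊆ (V : Set X))
    (hJY : ∀ z : X, (m : ℕ∞) ≤ idealOrder J z → z ∈ (Y : Set X) ∨ z ∉ (V : Set X))
    (hord : ∀ y ∈ (Y : Set X), idealOrder J y = m)
    {X' : Scheme.{u}} (π : X' ⟶ X) (hπ : IsBlowup π (vanishingIdeal Y))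
    (hnot : ¬ CampaignW46.OrderReducible (J.comap V.ι) m) :
    (∃ (_ : IsIntegral X') (_ : IsNoetherian X') (hX' : Scheme.IsRegular X') (_ : Scheme.IsQuasiExcellent X')
      (_ : topologicalKrullDim X' ≤ 3) (_ : ∀ z, idealOrder (controlledTransform π (vanishingIdeal Y) J m) z ≤ m)
      (_ : ∀ z ∈ (controlledTransform π (vanishingIdeal Y) J m).support, 1 < Order.coheight z)
      (x' : X') (_ : π x' ∈ (Y : Set X)) (_ : π x' ≠ η) (_ : IsClosed ({π x'} : Set X))
      (_ : IsNear π (vanishingIdeal Y) J m x') (W : X'.Opens) (_ : x' ∈ W) (_ : W ≤ π ⁻¹ᵁ V) (_ : IsClosed ({x'} : Set X'))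
      (_ : ∀ z : X', (m : ℕ∞) ≤ idealOrder (controlledTransform π (vanishingIdeal Y) J m) z → z = x' ∨ z ∉ (W : Set X'))
      (_ : idealOrder (controlledTransform π (vanishingIdeal Y) J m) x' = m)
      (_ : (maximalIdeal (X'.presheaf.stalk x')).spanFinrank = 3)
      (_ : haveI := hX' x'; stalkTau (controlledTransform π (vanishingIdeal Y) J m) x' m = 1)
      (_ : IsGRing (X'.presheaf.stalk x')),
      ¬ CampaignW46.OrderReducible ((controlledTransform π (vanishingIdeal Y) J m).comap W.ι) m) ∨
    (∃ η' : X', π η' = η ∧ IsNear π (vanishingIdeal Y) J m η' ∧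
      ¬ CampaignW46.OrderReducible ((controlledTransform π (vanishingIdeal Y) J m).comap (π ⁻¹ᵁ V).ι) m) := by
  by_contra hnone
  push Not at hnone
  obtain ⟨h1, h2⟩ := hnone
  exact hnot (orderReducible_comap_of_curve_step_local hm hX hqe hX3 J hle hcodim V Y η hYη hcoh hreg hYV hJY hord π hπ
    (fun a b c d e f g x' h i j k W l n o p q r s t => h1 a b c d e f g x' h i j k W l n o p q r s t)
    (fun η' hη' hnear => h2 η' hη' hnear))

/-! ## §3 The next curve instance (case B bookkeeping) -/

/-- **THE NEXT CURVE INSTANCE.** In the same situation, let `η′` over `η` be near, and GRANT two clauses of Lemma 4.3 (4) for `Γ′ = cl{η′}` —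
every point of `Γ′` near, `π(Γ′) = Y` (T2b′ clauses 2–3, in tree: p619499, res-inputs-p-6; the regularity clause is what the NEXT blow-up needs,
not this bookkeeping). Then `(X′, J′, π⁻¹V, Γ′, η′)` is again a curve instance: `X′` integral Noetherian
regular quasi-excellent of dimension `≤ 3`, `ord J′ ≤ m`, `V(J′)` of codimension `≥ 2`, `codim η′ = 2`, `Γ′ ⊆ π⁻¹V`, `ord = m` on `Γ′`, every
point of `X′` of order `≥ m` on `Γ′` or outside `π⁻¹V` (uniqueness of near points over a curve centre, p613580) — and the colength DROPPED:
`λ(𝒪_{X′,η′}/J′_{η′}) < λ(𝒪_{X,η}/J_η) < ⊤`. [cite: CossartPiltant2008, Prop. 4.4 (proof, p. 10), Lemma 4.3 (4)] [cite: ZariskiSamuel1960, Appendix 5, Thm. 3] -/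
theorem curveData_of_isNear_generic {m : ℕ} (hm : 1 ≤ m)
    {X : Scheme.{u}} [IsIntegral X] [IsNoetherian X] (hX : Scheme.IsRegular X) (hqe : Scheme.IsQuasiExcellent X)
    (hX3 : topologicalKrullDim X ≤ 3) (J : X.IdealSheafData) (hle : ∀ z, idealOrder J z ≤ m)
    (hcodim : ∀ z ∈ J.support, 1 < Order.coheight z) (V : X.Opens) (Y : Closeds X) (η : X) (hYη : (Y : Set X) = closure {η})
    (hcoh : Order.coheight η = 2) (hreg : Scheme.IsRegular (vanishingIdeal Y).subscheme) (hYV : (Y : Set X) ⊆ (V : Set X))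
    (hJY : ∀ z : X, (m : ℕ∞) ≤ idealOrder J z → z ∈ (Y : Set X) ∨ z ∉ (V : Set X))
    (hord : ∀ y ∈ (Y : Set X), idealOrder J y = m)
    {X' : Scheme.{u}} (π : X' ⟶ X) (hπ : IsBlowup π (vanishingIdeal Y)) {η' : X'} (hη'η : π η' = η)
    (hnearη' : IsNear π (vanishingIdeal Y) J m η')
    (hnearΓ : ∀ z ∈ closure ({η'} : Set X'), IsNear π (vanishingIdeal Y) J m z)
    (hontoΓ : π '' closure ({η'} : Set X') = (Y : Set X)) :
    IsIntegral X' ∧ IsNoetherian X' ∧ Scheme.IsRegular X' ∧ Scheme.IsQuasiExcellent X' ∧ topologicalKrullDim X' ≤ 3 ∧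
      (∀ z, idealOrder (controlledTransform π (vanishingIdeal Y) J m) z ≤ m) ∧
      (∀ z ∈ (controlledTransform π (vanishingIdeal Y) J m).support, 1 < Order.coheight z) ∧
      Order.coheight η' = 2 ∧
      closure ({η'} : Set X') ⊆ ((π ⁻¹ᵁ V : X'.Opens) : Set X') ∧
      (∀ z : X', (m : ℕ∞) ≤ idealOrder (controlledTransform π (vanishingIdeal Y) J m) z →
        z ∈ closure ({η'} : Set X') ∨ z ∉ ((π ⁻¹ᵁ V : X'.Opens) : Set X')) ∧
      (∀ y ∈ closure ({η'} : Set X'), idealOrder (controlledTransform π (vanishingIdeal Y) J m) y = m) ∧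
      Module.length (X'.presheaf.stalk η') (X'.presheaf.stalk η' ⧸ stalkIdeal (controlledTransform π (vanishingIdeal Y) J m) η') <
        Module.length (X.presheaf.stalk η) (X.presheaf.stalk η ⧸ stalkIdeal J η) ∧
      Module.length (X.presheaf.stalk η) (X.presheaf.stalk η ⧸ stalkIdeal J η) < ⊤ := by
  classical
  have hcoh3 : ∀ z : X, Order.coheight z ≤ 3 := (topologicalKrullDim_le_iff_forall_coheight_le X 3).mp hX3
  have hηY : η ∈ (Y : Set X) := by rw [hYη]; exact subset_closure rfl
  have hD : ∀ y ∈ (Y : Set X), (m : ℕ∞) ≤ idealOrder J y := fun y hy => (hord y hy).ge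
  have hpair : ∀ y ∈ (Y : Set X), haveI := hX y; ∃ c : Fin 2 → X.presheaf.stalk y, IsRsopPart c ∧
      Ideal.span (Set.range c) = stalkIdeal (vanishingIdeal Y) y := fun y hy =>
    exists_rsopPair_of_mem_curve hX hcoh3 hreg hYη hcoh hy
  have hseq1 : CampaignW46.IsPermissibleBlowupSeq J m π (controlledTransform π (vanishingIdeal Y) J m) :=
    CampaignW46.IsPermissibleBlowupSeq.single Y π hreg hD hπ
  obtain ⟨hint', hnoeth', hX', hqe', hle', hcodim'⟩ := IsPermissibleBlowupSeq.prop44Invariants hX hqe hm hle hcodim hseq1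
  haveI := hint'
  haveI := hnoeth'
  have hX3' : topologicalKrullDim X' ≤ 3 := hπ.topologicalKrullDim_le hX3
  set J' := controlledTransform π (vanishingIdeal Y) J m with hJ'def
  have hbad' : ∀ z : X', (m : ℕ∞) ≤ idealOrder J' z →
      (π z ∈ (Y : Set X) ∧ IsNear π (vanishingIdeal Y) J m z) ∨ π z ∉ (V : Set X) := by
    intro z hz
    by_cases hmem : π z ∈ (Y : Set X)
    · exact Or.inl ⟨hmem, isNear_iff.mpr (le_antisymm (hπ.idealOrder_controlledTransform_le_of_mem hX hreg hord hmem) hz)⟩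
    · right
      have hmem' : π z ∉ ((vanishingIdeal Y).support : Set X) := by rwa [Scheme.IdealSheafData.coe_support_vanishingIdeal]
      rw [hJ'def, hπ.idealOrder_controlledTransform_of_not_mem J m hmem'] at hz
      rcases hJY _ hz with h | h
      · exact absurd h hmem
      · exact h
  have hcohπη' : Order.coheight (π η') = 2 := by rw [hη'η]; exact hcoh
  have hcohη' : Order.coheight η' = 2 := by
    apply le_antisymm
    · have h := hπ.coheight_le η'
      rwa [hcohπη'] at h
    · have hsupp : η' ∈ J'.support := by
        rw [← one_le_idealOrder_iff, hJ'def, isNear_iff.mp hnearη']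
        exact_mod_cast hm
      exact Order.add_one_le_of_lt (hcodim' η' hsupp)
  have hordΓ : ∀ z ∈ closure ({η'} : Set X'), idealOrder J' z = m := fun z hz => isNear_iff.mp (hnearΓ z hz)
  have hΓV : closure ({η'} : Set X') ⊆ ((π ⁻¹ᵁ V : X'.Opens) : Set X') := by
    intro z hz
    show π z ∈ (V : Set X)
    exact hYV (hontoΓ ▸ Set.mem_image_of_mem π hz)
  have hbadΓ : ∀ z : X', (m : ℕ∞) ≤ idealOrder J' z →
      z ∈ closure ({η'} : Set X') ∨ z ∉ ((π ⁻¹ᵁ V : X'.Opens) : Set X') := by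
    intro z hz
    rcases hbad' z hz with ⟨hzY, hzn⟩ | h
    · left
      obtain ⟨γ, hγ, hπγ⟩ : ∃ γ ∈ closure ({η'} : Set X'), π γ = π z := by
        have : π z ∈ π '' closure ({η'} : Set X') := by rw [hontoΓ]; exact hzY
        exact this
      haveI := hX (π z)
      obtain ⟨c, hcr, hcY⟩ := hpair (π z) hzY
      have hγz : γ = z := hπ.eq_of_isNear_of_isNear_curve hX hreg hm hord hcr hcY hzn (hnearΓ γ hγ) hπγ
      rw [← hγz]
      exact hγ
    · exact Or.inr h
  haveI := hX η
  have hmax : η ∈ maxPoints (J.support : Set X) :=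
    mem_maxPoints_support_of_coheight_eq_two hcodim
      (by rw [SetLike.mem_coe, ← one_le_idealOrder_iff, hord η hηY]; exact_mod_cast hm) hcoh
  have hlt : Module.length (X'.presheaf.stalk η') (X'.presheaf.stalk η' ⧸ stalkIdeal J' η') <
      Module.length (X.presheaf.stalk η) (X.presheaf.stalk η ⧸ stalkIdeal J η) :=
    hπ.colength_weakTransform_lt hm hord hη'η (isNear_iff.mp hnearη') (hX η) (spanFinrank_maximalIdeal_stalk_eq η hcoh)
      (stalkIdeal_vanishingIdeal_eq_maximalIdeal_of_closure_eq hYη) (isFiniteLength_quotient_stalkIdeal_of_mem_maxPoints hmax)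
  have hfin : Module.length (X.presheaf.stalk η) (X.presheaf.stalk η ⧸ stalkIdeal J η) < ⊤ :=
    lt_top_iff_ne_top.mpr (length_quotient_stalkIdeal_ne_top_of_mem_maxPoints hmax)
  exact ⟨hint', hnoeth', hX', hqe', hX3', hle', hcodim', hcohη', hΓV, hbadΓ, hordΓ, hlt, hfin⟩

end CP2008Prop44

end Summit.ResolutionOfSingularities.ResolutionOfSingularities.Theorems

end
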